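import Literature.MathematicalPhysics.QuantumLattice.HubbardScaleReportCT
import Summits.HubbardSuperconductivity.HubbardSuperconductivity.Theorems.AposterioriCapRgSeededBrokenRegimeBoseFermiPinnedQuadraticFormKernelFour

/-!
# Crux `SeededBrokenRegimeBoseFermiPinned` (stmt-HubbardSuperconductivity-14047), line `seed-strength-flow` — stub `stub_cooperKeptKernelAnomalous` (N2)

WHAT. The kept Cooper term `𝒦^K(F) = cooperKeptCT L M β μ K Λ₀ F`
(`Literature/MathematicalPhysics/QuantumLattice/HubbardScaleReportCT.lean`) is a `ℂ`-linear combination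
of the monomials `ψ⁺_{k₁↑} ψ⁺_{k₂↓} ψ⁻_{k₄↓} ψ⁻_{k₃↑}`, each carrying exactly two generators of charge
index `0` (`ψ⁺`) and two of charge index `1` (`ψ⁻`).  Its `4`-point kernel
`kernel ℂ 𝒦 4 X = (4!)⁻¹ · constPart (∂_{X₃}∂_{X₂}∂_{X₁}∂_{X₀} 𝒦)`
(`Literature/MathematicalPhysics/QuantumLattice/GrassmannKernels.lean`) therefore vanishes at every
configuration `X` whose four legs carry the SAME charge index `c`: the monomial contains a generator
`ψ(A)` of the opposite charge, which no derivative `∂_{X_i}` can hit (`X_i ≠ A`), so after moving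
`ψ(A)` to the front (a generator commutes with a pair of generators) the four derivatives pass through
it with signs and `constPart (ψ(A) · …) = 0`.  This is the formal content of "the anomalous blocks
`B̄B̄` / `BB` (`ψ⁺ψ⁺ψ⁺ψ⁺` / `ψ⁻ψ⁻ψ⁻ψ⁻`) are not kept".

SOURCE: folklore (degree/charge count in a finite-dimensional Grassmann algebra).

The file proves, in the sub-namespace `CooperKeptKernelAnomalous`, the generic facts
`gen_mul_gen_mul_gen_comm` (`ψ(a)ψ(b)ψ(c) = ψ(c)ψ(a)ψ(b)`) and
`constPart_iterDeriv_four_gen_mul_of_ne` (`constPart (iterDeriv X (ψ(a) · m)) = 0` when no `X_i`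
equals `a`; the four derivatives are unfolded by `QuadraticFormKernelFour.iterDeriv_four_apply` of the
sibling N1 file `…QuadraticFormKernelFour.lean`), then the single-monomial statement
`constPart_iterDeriv_four_cooperMonomial`, the `constPart ∘ iterDeriv` form
`constPart_iterDeriv_four_cooperKeptCT` by linearity, and finally the registered stub.
-/

set_option linter.dupNamespace false -- Summit.<S>.<S> doubles the summit name (tree convention)

namespace Summit.HubbardSuperconductivity.HubbardSuperconductivity.Theorems.AposterioriCapRgSeededBrokenRegimeBoseFermiPinned

open Literature.MathematicalPhysics.QuantumLattice Literature.Probability.LatticeModels GrassmannAlgebra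

namespace CooperKeptKernelAnomalous

/-! ### Generic: a generator no derivative can hit kills the constant part -/

section Generic

variable (R : Type*) [CommRing R] {Γ : Type*} [DecidableEq Γ]

/-- A generator commutes with a pair of generators: `ψ(a)ψ(b)ψ(c) = ψ(c)ψ(a)ψ(b)` (two
anticommutations). [folklore] -/
theorem gen_mul_gen_mul_gen_comm (a b c : Γ) :
    gen R a * gen R b * gen R c = gen R c * (gen R a * gen R b) := by
  rw [mul_assoc, gen_mul_gen R b c, mul_neg, ← mul_assoc, gen_mul_gen R a c, neg_mul, neg_neg,
    mul_assoc]

/-- If none of the four labels `X_i` equals `a`, then `constPart (∂_{X₃}∂_{X₂}∂_{X₁}∂_{X₀} (ψ(a) · m)) = 0`: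
each derivative passes through `ψ(a)` with a sign (`∂_{X_i} ψ(a) = 0`), and `constPart` kills the
surviving generator. [folklore] -/
theorem constPart_iterDeriv_four_gen_mul_of_ne (X : Fin 4 → Γ) {a : Γ} (m : GrassmannAlgebra R Γ)
    (ha : ∀ i, X i ≠ a) : constPart R (iterDeriv R X (gen R a * m)) = 0 := by
  rw [QuadraticFormKernelFour.iterDeriv_four_apply]
  simp only [grassmannDeriv_gen_mul, if_neg (ha _), zero_sub, map_neg, neg_neg, map_mul,
    constPart_gen, zero_mul]

end Generic

/-! ### The Cooper monomial has no same-charge quartic coefficient -/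

/-- For a configuration `X : Fin 4 → HubbardFieldIdx L M` whose four legs carry the same charge
index `c`, the Cooper monomial `ψ⁺_{k₁↑} ψ⁺_{k₂↓} ψ⁻_{k₄↓} ψ⁻_{k₃↑}` (two generators of each charge)
has `constPart (iterDeriv X ·) = 0`: for `c = 0` no leg hits `ψ⁻_{k₄↓}` (moved to the front by
`gen_mul_gen_mul_gen_comm`), for `c = 1` no leg hits `ψ⁺_{k₁↑}`. [folklore] -/
theorem constPart_iterDeriv_four_cooperMonomial (L M : ℕ) (X : Fin 4 → HubbardFieldIdx L M)
    (c : Fin 2) (hX : ∀ i, (X i).2 = c) (k₁ k₂ k₃ k₄ : FreqMomentum L M) :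
    constPart ℂ (iterDeriv ℂ X (psiPlus k₁ 0 * psiPlus k₂ 1 * psiMinus k₄ 1 * psiMinus k₃ 0)) = 0 := by
  simp only [psiPlus, psiMinus]
  -- a label of charge `≠ c` is never hit by a leg of `X`
  have key : ∀ A : HubbardFieldIdx L M, A.2 ≠ c → ∀ i, X i ≠ A := fun A hA i h => hA (h ▸ hX i)
  by_cases hc : c = 0
  · rw [gen_mul_gen_mul_gen_comm, mul_assoc]
    exact constPart_iterDeriv_four_gen_mul_of_ne ℂ X _ (key ((k₄, 1), 1) (by simp [hc]))
  · rw [mul_assoc, mul_assoc]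
    exact constPart_iterDeriv_four_gen_mul_of_ne ℂ X _ (key ((k₁, 0), 0) fun h0 => hc h0.symm)

/-- `constPart (iterDeriv X 𝒦^K(F)) = 0` at every same-charge configuration `X`: the kept Cooper term
`cooperKeptCT L M β μ K Λ₀ F` is a `ℂ`-linear combination of Cooper monomials, each killed by
`constPart_iterDeriv_four_cooperMonomial` (the `constPart ∘ iterDeriv` shape entering `cooperVertex`).
[folklore] -/
theorem constPart_iterDeriv_four_cooperKeptCT (L M : ℕ) [NeZero L] (β μ : ℝ) (K : TrigPolyC4v) (Λ₀ : ℝ)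
    (F : HubbardGrassmann L M) (X : Fin 4 → HubbardFieldIdx L M) (c : Fin 2) (hX : ∀ i, (X i).2 = c) :
    constPart ℂ (iterDeriv ℂ X (cooperKeptCT L M β μ K Λ₀ F)) = 0 := by
  rw [cooperKeptCT]
  simp only [map_sum]
  refine Finset.sum_eq_zero fun k₁ _ => Finset.sum_eq_zero fun k₂ _ =>
    Finset.sum_eq_zero fun k₃ _ => Finset.sum_eq_zero fun k₄ _ => ?_
  split_ifs
  · simp only [map_smul, constPart_iterDeriv_four_cooperMonomial L M X c hX, smul_zero]
  · rw [map_zero, map_zero]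

end CooperKeptKernelAnomalous

/-! ### N2 -/

/-- **N2 (`CooperKeptKernelAnomalous`)**: the kept Cooper term `𝒦^K(F) = cooperKeptCT L M β μ K Λ₀ F`
(monomials `ψ⁺↑ψ⁺↓ψ⁻↓ψ⁻↑`) has vanishing `4`-point kernel at every configuration whose four legs carry
the SAME charge index (`ψ⁺ψ⁺ψ⁺ψ⁺` or `ψ⁻ψ⁻ψ⁻ψ⁻`): the anomalous blocks `B̄B̄`, `BB` are not kept.
[folklore] -/
theorem stub_cooperKeptKernelAnomalous :
    ∀ (L M : ℕ) [NeZero L] (β μ : ℝ) (K : TrigPolyC4v) (Λ₀ : ℝ) (F : HubbardGrassmann L M)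
      (X : Fin 4 → HubbardFieldIdx L M) (c : Fin 2), (∀ i, (X i).2 = c) →
        kernel ℂ (cooperKeptCT L M β μ K Λ₀ F) 4 X = 0 := by
  intro L M _ β μ K Λ₀ F X c hX
  rw [kernel_def, CooperKeptKernelAnomalous.constPart_iterDeriv_four_cooperKeptCT L M β μ K Λ₀ F X c hX,
    mul_zero]

end Summit.HubbardSuperconductivity.HubbardSuperconductivity.Theorems.AposterioriCapRgSeededBrokenRegimeBoseFermiPinned
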